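import Literature.NumberTheory.Rogawski1990.ExplicitFactorProductFormulaParts
import Literature.NumberTheory.Rogawski1990.ExplicitFactorRationalLocalisation
import Literature.NumberTheory.Rogawski1990.AdelicStableClassesProductGp
import Literature.NumberTheory.Rogawski1990.GRegularLocalisation
import Literature.NumberTheory.Rogawski1990.AdelicDeltaTransfer
import HarnessLib

/-!
# THE PRODUCT FORMULA FOR ROGAWSKI'S EXPLICIT TRANSFER FACTORS: `(∏_v Δ‴_v(γ_H, γ)) · Δ‴_∞(γ_H ⊗ 1, γ ⊗ 1) = 1` on every rational
# matching `G`-regular pair — ★ `SatisfiesProductFormula L H′ (finExplicitCollection L H′ μ hl hr) (archCanonicalDelta L H′ · μ ·)`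

Topic `NumberTheory/Rogawski1990`; namespace `Literature.NumberTheory.Rogawski1990`.  THEOREMS ONLY (no definition, no named fact, no instance, no notation,
no `sorry`; net debt 0).  PART 2 of 2 (§4–§5; PART 1 = ★ `ExplicitFactorProductFormulaParts.lean`: §1–§3).  Cell `pub/hodgecm-mathlib`, F0∕P3a, topic T6, node **N4** of `F0/P3a/T6b-TREE.md` §9 (F4) (desk TABLE #3 row (5)): the product-formula
clause of the #72 letter ★ `GlobalTransferWithCartanKappaFormula` AT PRINT'S EXPLICIT COLLECTION (★ N1f `finExplicitCollection`, p827456; ★ `archCanonicalDelta`,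
p827252) is a THEOREM.  Print: «By a global property of transfer factors (cf. §4.9), `Π_v Δ′_v(γ, i(γ)) = 1`», «`Π_v Δ_v(γ, γ) = 1`» [Rogawski1990 §14.6 p. 242];
«the product formula `ΠΔ_{G_v∕H_v}(γ_{0v}) = 1` for `γ_0 ∈ M`» [§4.3 (4.3.3) p. 44]; [LanglandsShelstad1987 §6.4].

THE PROOF.  On a rational pair `(γ_H, γ)`, `γ_H = (g, u) ∈ H(L⁺)` `G`-regular, `γ ∈ U(H′)(L⁺)` with `ι(γ_H) ↔ γ` (★ `IsNormPair`; localised at every place by ★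
`isLocalNormPair_rationalComponent_toLocal_toAdelic`, ★ `isArchNormPair_rationalArch_cmRationalToArch`), each explicit factor is `τ · D_{G∕H} · κ` (★
`finExplicitDelta_of_isLocalNormPair`, ★ `archCanonicalDelta_of_isArchNormPair`) and every local ingredient is the image of a GLOBAL element (★ (R)
`ExplicitFactorRationalLocalisation`, p827972): `u`, `a = −χ_g(u)∕det g`, `k = χ_g(u)` in `Lˣ` (★ `gammaTwo_ne_zero`, ★ `eval_charpoly_gammaTwo_ne_zero_of_isGRegular` of A-p16's N3 FILE A, `tauArg_ne_zero`), and the relative position.  The three factors then die separately: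
* §1∕§5 `τ`: `μ_∞(u)μ_∞(a)⁻¹ · ∏_v μ_v(u)μ_v(a)⁻¹ = 1` — a Hecke character is trivial on principal idèles (★ `archHeckeValue_mul_finprod_semilocalComponent_eq_one`,
  p827658; here `archHeckeValue_div_mul_finprod_finHeckeValue_div_eq_one`, `finprod_finTau_mul_archTau_eq_one`);
* §2∕§5 `D_{G∕H}`: `(∏_w ‖σ_w k‖) · ∏_v √(∏_{w∣v} ‖k‖_w) = 1` — Artin–Whaples (★ `prod_norm_evalC_mul_finprod_sqrt_prod_placesOver_norm_eq_one`; here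
  `prod_norm_embedding_mul_finprod_sqrt_eq_one`, `finprod_finWeylRatio_mul_archWeylRatio_eq_one`);
* §3∕§4∕§5 `κ`: ALL the `κ`'s are Hilbert symbols of ONE `x ∈ (L⁺)ˣ` (`exists_kappa_eq_hilbertSymbol`): `x = p_{j₀}ᴴ H′ p_{j₀}` for the first non-zero column `p_{j₀}`
  of the global projector `P = χ_g(γ) ≠ 0` (`globalProjector_ne_zero`), which is `c`-fixed (`complexConj_columnFormValue`, `H′` hermitian); at a finite `v`,
  ★ `finKappaAt_rationalComponent` + the local bridge ★ `UnitaryGroup.ite_normTest_algebraMap_eq_hilbertSymbol` (p827951) give `κ_v = (x, θ)_v`; at a complex `w`,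
  `P_w = σ_w(P) = v qᵀ` (★ `archEigenlineProjector_eq_vecMulVec_of_conj_eq`), `tr(P_wᴴ H P_w) = ‖q‖² vᴴHv`, `σ_w(x) = |q_{j₀}|² vᴴHv` with `q_{j₀} ≠ 0` and
  `vᴴHv ∈ ℝˣ` (★ `star_dotProduct_form_mulVec_ne_zero_of_conj_eq`), so `κ‴_w = sgn Re σ_w(x) = (x, θ)_{w|L⁺}` (`archKappaSignAt_eq_sign_re_embedding_columnFormValue`,
  `hilbertSymbol_equivInfinitePlace_eq_sign`; `θ` = ★ `cmQuadraticGenerator`, totally negative); and `(∏_v (x, θ)_v) · ∏_{w′} (x, θ)_{w′} = 1` is Hilbert reciprocity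
  (★ `finprod_hilbertSymbol_mul_prod_infinitePlace_hilbertSymbol_eq_one`, from ★ `hilbertReciprocity_holds`), the complex places of `L` being the infinite places of
  `L⁺` (Mathlib `IsCMField.equivInfinitePlace`) — `finprod_finKappaAt_mul_prod_archKappaSignAt_eq_one`.
* §5 **`satisfiesProductFormula_finExplicitCollection`**: the three finitely supported products split (`finprod_mul_distrib`; supports from the a.e. riders of
  p827658) and regroup.
Hypotheses: `hherm : (H′.map c)ᵀ = H′`, `hanis` (anisotropy of `H′` on `L³`) — the T1 head's own binders; `μ` ANY Hecke character of `L`; `hl hr` the invariance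
families of ★ `finExplicitCollection` (★ p827517, ★ p827808 discharge them).
HONEST LABEL: HC_CM is proved only modulo the printed citations (named inputs remaining 2) until rung 0 closes; this file discharges the product-formula CLAUSE of #72
at the explicit collection and nothing else (the local transfer N6 and unit fundamental lemma N7 remain print's citations).

## References
* [Rogawski1990] J. D. Rogawski, *Automorphic Representations of Unitary Groups in Three Variables*, Ann. of Math. Stud. 123 (1990), §4.3 (4.3.3) p. 44, §4.9 p. 55,
  §14.6 p. 242; §3.5 Prop. 3.5.2 (c) p. 29.
* [LanglandsShelstad1987] R. P. Langlands, D. Shelstad, *On the definition of transfer factors*, Math. Ann. 278 (1987), §6.3–§6.4 (global hypothesis, product formula).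
* [Omeara1963] O. T. O'Meara, *Introduction to Quadratic Forms* (1963), §63B, §71 Thm. 71:18.
* [NeukirchANT1999] J. Neukirch, *Algebraic Number Theory* (1999), Ch. VII §6 (6.13).
* [CasselsFrohlichANT1967] J. W. S. Cassels, A. Fröhlich (eds.), *Algebraic Number Theory* (1967), Ch. II §12 (product formula).
-/
set_option autoImplicit false

noncomputable section

open NumberField NumberField.InfinitePlace NumberField.mixedEmbedding IsDedekindDomain Filter Matrix
open Literature.NumberTheory.GaloisRepresentations
open Literature.AlgebraicGeometry.ShimuraVarieties (hermForm)
open scoped Classical ComplexOrder MatrixGroups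

namespace Literature.NumberTheory.Rogawski1990

open Literature.NumberTheory.Automorphic

variable (L : Type) [Field L] [NumberField L]

/-! ## §4 The `κ`-part on a rational `G`-regular matching pair: every `κ` is a Hilbert symbol of ONE global `x ∈ (L⁺)ˣ` -/

section KappaPair

variable [IsCMField L] (H' : Matrix (Fin 3) (Fin 3) L)
  (γH : (UnitaryGroup.cmDatum L 2 (Matrix.of fun i j : Fin 2 => if i.val + j.val + 1 = 2 then (1 : L) else 0)).Rational ×
      (UnitaryGroup.cmDatum L 1 (Matrix.of fun i j : Fin 1 => if i.val + j.val + 1 = 1 then (1 : L) else 0)).Rational)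
  (γ : (UnitaryGroup.cmDatum L 3 H').Rational)

/-- **The global projector `P = γ² − tr g·γ + det g` of a rational `G`-regular matching pair is non-zero** (its `σ_w`-image carries `κ_w ≠ 0`, ★
`archKappaAt_ne_zero`, ★ `archEigenlineProjector_rationalArch`). [cite: Rogawski1990, §14.6 p. 242; §4.9 p. 55] -/
theorem globalProjector_ne_zero (hherm : (H'.map (cmConjRingHom L)).transpose = H')
    (hanis : ∀ x : Fin 3 → L, hermForm (cmConjRingHom L) H' x x = 0 → x = 0)
    (hreg : IsGRegular (cmConjRingHom L) (Matrix.of fun i j : Fin 2 => if i.val + j.val + 1 = 2 then (1 : L) else 0)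
        (Matrix.of fun i j : Fin 1 => if i.val + j.val + 1 = 1 then (1 : L) else 0)
        (Matrix.of fun i j : Fin 3 => if i.val + j.val + 1 = 3 then (1 : L) else 0) endoForm_antidiagOne γH)
    (hγ : IsNormPair L H' γH γ) :
    ((γ.val.val : Matrix (Fin 3) (Fin 3) L) * γ.val.val - (γH.1.val.val : Matrix (Fin 2) (Fin 2) L).trace • (γ.val.val : Matrix (Fin 3) (Fin 3) L) +
        (γH.1.val.val : Matrix (Fin 2) (Fin 2) L).det • (1 : Matrix (Fin 3) (Fin 3) L)) ≠ 0 := by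
  intro hP
  obtain ⟨w⟩ : Nonempty (InfinitePlace L) := inferInstance
  let wc : {w : InfinitePlace L // IsComplex w} := ⟨w, IsTotallyComplex.isComplex w⟩
  have hne := archKappaAt_ne_zero L H' (rationalArch L γH) (cmRationalToArch L 3 H' γ) wc hherm hanis
    (isArchNormPair_rationalArch_cmRationalToArch hγ) (isArchGRegular_cmRationalToArch_of_isGRegular L γH hreg)
  apply hne
  unfold archKappaAt
  rw [archEigenlineProjector_rationalArch, hP, Matrix.map_zero _ (map_zero _), Matrix.mul_zero, Matrix.trace_zero, Complex.zero_re, sign_zero,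
    SignType.coe_zero, zero_mul]

/-- **ALL THE `κ`'S OF A RATIONAL PAIR ARE HILBERT SYMBOLS OF ONE GLOBAL ELEMENT.**  For a rational `G`-regular matching pair `(γ_H, γ)` (`c`-hermitian anisotropic
`H′`) there is `x ∈ (L⁺)ˣ` — the `H′`-value `p_{j₀}ᴴ H′ p_{j₀}` of the first non-zero column of the global projector `P`, a `γ₂`-eigenvector of `γ` — with
`κ_v((γ_H)_v, γ_v) = (x, θ)_v` at EVERY finite place `v` of `L⁺` (★ `finKappaAt_rationalComponent` + ★ `UnitaryGroup.ite_normTest_algebraMap_eq_hilbertSymbol`) and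
`κ‴_w(γ_H ⊗ 1, γ ⊗ 1) = (x, θ)_{w|L⁺}` at every complex place `w` (`archKappaSignAt_eq_sign_re_embedding_columnFormValue` + `hilbertSymbol_equivInfinitePlace_eq_sign`),
`θ` = ★ `cmQuadraticGenerator L` (`L = L⁺(√θ)`, `θ` totally negative).  Print: «`κ(γ, ψ_v(i(γ)))` is equal to `±1`» read as the local norm-residue symbols of
`inv(γ_H, γ)`. [cite: Rogawski1990, §14.6 p. 242; §3.5 Prop. 3.5.2 (c) p. 29] [cite: LanglandsShelstad1987, §6.3–6.4] -/
theorem exists_kappa_eq_hilbertSymbol (hherm : (H'.map (cmConjRingHom L)).transpose = H')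
    (hanis : ∀ x : Fin 3 → L, hermForm (cmConjRingHom L) H' x x = 0 → x = 0)
    (hreg : IsGRegular (cmConjRingHom L) (Matrix.of fun i j : Fin 2 => if i.val + j.val + 1 = 2 then (1 : L) else 0)
        (Matrix.of fun i j : Fin 1 => if i.val + j.val + 1 = 1 then (1 : L) else 0)
        (Matrix.of fun i j : Fin 3 => if i.val + j.val + 1 = 3 then (1 : L) else 0) endoForm_antidiagOne γH)
    (hγ : IsNormPair L H' γH γ) :
    ∃ x : ↥(maximalRealSubfield L), x ≠ 0 ∧
      (∀ v : HeightOneSpectrum (𝓞 ↥(maximalRealSubfield L)),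
        finKappaAt L v H' (rationalComponent L γH v) ((UnitaryGroup.cmDatum L 3 H').toLocal v ((UnitaryGroup.cmDatum L 3 H').toAdelic γ)) =
          QuadraticForms.hilbertSymbol (v.adicCompletion ↥(maximalRealSubfield L)) (x : v.adicCompletion ↥(maximalRealSubfield L))
            ((cmQuadraticGenerator L : ↥(maximalRealSubfield L)) : v.adicCompletion ↥(maximalRealSubfield L))) ∧
      (∀ w : {w : InfinitePlace L // IsComplex w},
        archKappaSignAt L H' (rationalArch L γH) w (cmRationalToArch L 3 H' γ) =
          QuadraticForms.hilbertSymbol (IsCMField.equivInfinitePlace L w.1).Completion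
            (algebraMap ↥(maximalRealSubfield L) _ x) (algebraMap ↥(maximalRealSubfield L) _ (cmQuadraticGenerator L : ↥(maximalRealSubfield L)))) := by
  -- the global projector, its first non-zero column, the global relative position `x₀ ∈ L` and its descent `x ∈ L⁺`
  set P : Matrix (Fin 3) (Fin 3) L := (γ.val.val : Matrix (Fin 3) (Fin 3) L) * γ.val.val -
      (γH.1.val.val : Matrix (Fin 2) (Fin 2) L).trace • (γ.val.val : Matrix (Fin 3) (Fin 3) L) +
        (γH.1.val.val : Matrix (Fin 2) (Fin 2) L).det • (1 : Matrix (Fin 3) (Fin 3) L) with hPdef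
  have hP0 : P ≠ 0 := globalProjector_ne_zero L H' γH γ hherm hanis hreg hγ
  have h : ∃ j : Fin 3, ∃ i : Fin 3, P i j ≠ 0 := by
    by_contra hcon
    refine hP0 (Matrix.ext fun i j => ?_)
    by_contra hne
    exact hcon ⟨j, i, hne⟩
  set j₀ : Fin 3 := Fin.find (fun j : Fin 3 => ∃ i : Fin 3, P i j ≠ 0) h with hj₀def
  have hj₀ : ∃ i : Fin 3, P i j₀ ≠ 0 := Fin.find_spec h
  set x₀ : L := ∑ i : Fin 3, ∑ k : Fin 3, IsCMField.complexConj L (P i j₀) * H' i k * P k j₀ with hx₀def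
  have hx₀c : IsCMField.complexConj L x₀ = x₀ := complexConj_columnFormValue L H' hherm P j₀
  have hx₀mem : x₀ ∈ maximalRealSubfield L := (IsCMField.complexConj_eq_self_iff L x₀).1 hx₀c
  set x : ↥(maximalRealSubfield L) := ⟨x₀, hx₀mem⟩ with hxdef
  have hxx₀ : algebraMap ↥(maximalRealSubfield L) L x = x₀ := rfl
  -- arch data
  have hparch := isArchNormPair_rationalArch_cmRationalToArch hγ
  have hrarch := isArchGRegular_cmRationalToArch_of_isGRegular L γH hreg
  have harch : ∀ w : {w : InfinitePlace L // IsComplex w},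
      archKappaSignAt L H' (rationalArch L γH) w (cmRationalToArch L 3 H' γ) = (SignType.sign ((w.1.embedding x₀).re) : ℤ) := fun w =>
    archKappaSignAt_eq_sign_re_embedding_columnFormValue L H' (rationalArch L γH) (cmRationalToArch L 3 H' γ) w hherm hanis hparch hrarch
      (archEigenlineProjector_rationalArch L H' γH w γ) hj₀
  -- `x ≠ 0`: at any complex place `κ‴_w ≠ 0`
  have hx0 : x ≠ 0 := by
    obtain ⟨w⟩ : Nonempty (InfinitePlace L) := inferInstance
    let wc : {w : InfinitePlace L // IsComplex w} := ⟨w, IsTotallyComplex.isComplex w⟩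
    have hne := archKappaAt_ne_zero L H' (rationalArch L γH) (cmRationalToArch L 3 H' γ) wc hherm hanis hparch hrarch
    rw [archKappaAt_eq_archKappaSignAt_mul, harch wc] at hne
    intro hx
    apply hne
    have : x₀ = 0 := by rw [← hxx₀, hx, map_zero]
    rw [this, map_zero, Complex.zero_re, sign_zero, SignType.coe_zero, zero_mul]
  -- the CM generator
  obtain ⟨α, hα0, hαc, hαsq⟩ := cmQuadraticGenerator_spec L
  have hαα : α * α = algebraMap ↥(maximalRealSubfield L) L (cmQuadraticGenerator L : ↥(maximalRealSubfield L)) := by rw [← sq]; exact hαsq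
  refine ⟨x, hx0, fun v => ?_, fun w => ?_⟩
  · -- finite place
    rw [finKappaAt_rationalComponent, if_neg hP0, dif_pos h]
    change (if ¬ Subsingleton (UnitaryGroup.PlacesOver L v) then (1 : ℤ)
      else if ∃ z : UnitaryGroup.LocalRing L v, IsUnit z ∧
          algebraMap L (UnitaryGroup.LocalRing L v) (algebraMap ↥(maximalRealSubfield L) L x) =
            z * UnitaryGroup.conjLocal L (IsCMField.complexConj L) v z then 1 else -1) = _
    exact UnitaryGroup.ite_normTest_algebraMap_eq_hilbertSymbol L (IsCMField.complexConj L) hαc hα0 hαα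
      (IsCMField.complexConj_ne_one L) v hx0
  · -- complex place
    rw [harch w, hilbertSymbol_equivInfinitePlace_eq_sign L w.1 hx0, hxx₀]

end KappaPair

/-! ## §5 The three partial products on a rational `G`-regular matching pair, and the product formula -/

section Assembly

variable [IsCMField L] (H' : Matrix (Fin 3) (Fin 3) L) (μ : HeckeCharacter L)
  (γH : (UnitaryGroup.cmDatum L 2 (Matrix.of fun i j : Fin 2 => if i.val + j.val + 1 = 2 then (1 : L) else 0)).Rational ×
      (UnitaryGroup.cmDatum L 1 (Matrix.of fun i j : Fin 1 => if i.val + j.val + 1 = 1 then (1 : L) else 0)).Rational)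

omit [IsCMField L] in
/-- A global element whose `mixedEmbedding` is a unit of `L ⊗ ℝ` is non-zero. [folklore] -/
private theorem ne_zero_of_isUnit_mixedEmbedding {k : L} (h : IsUnit (mixedEmbedding L k)) : k ≠ 0 := by
  rintro rfl
  rw [map_zero] at h
  exact not_isUnit_zero h

/-- The `τ`-argument `−χ_g(u)·det g⁻¹ ≠ 0` for a rational `G`-regular `γ_H` (★ `isUnit_archTauArg_of_isArchGRegular`). [cite: Rogawski1990, §4.9 p. 55] -/
theorem tauArg_ne_zero
    (hreg : IsGRegular (cmConjRingHom L) (Matrix.of fun i j : Fin 2 => if i.val + j.val + 1 = 2 then (1 : L) else 0)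
        (Matrix.of fun i j : Fin 1 => if i.val + j.val + 1 = 1 then (1 : L) else 0)
        (Matrix.of fun i j : Fin 3 => if i.val + j.val + 1 = 3 then (1 : L) else 0) endoForm_antidiagOne γH) :
    -(((γH.1.val.val : Matrix (Fin 2) (Fin 2) L).charpoly).eval ((γH.2.val.val : Matrix (Fin 1) (Fin 1) L) 0 0)) *
        (((γH.1.val⁻¹).val : Matrix (Fin 2) (Fin 2) L).det) ≠ 0 := by
  have h := isUnit_archTauArg_of_isArchGRegular L (rationalArch L γH) (isArchGRegular_cmRationalToArch_of_isGRegular L γH hreg)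
  rw [archTauArg_rationalArch] at h
  exact ne_zero_of_isUnit_mixedEmbedding L h

/-- **`τ`-PART: `(∏_v τ_v((γ_H)_v)) · τ_∞(γ_H ⊗ 1) = 1`** for a rational `G`-regular `γ_H` (★ `finTau_rationalComponent`, ★ `archTau_rationalArch`,
`archHeckeValue_div_mul_finprod_finHeckeValue_div_eq_one`). [cite: Rogawski1990, §4.9 p. 55; §14.6 p. 242] -/
theorem finprod_finTau_mul_archTau_eq_one
    (hreg : IsGRegular (cmConjRingHom L) (Matrix.of fun i j : Fin 2 => if i.val + j.val + 1 = 2 then (1 : L) else 0)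
        (Matrix.of fun i j : Fin 1 => if i.val + j.val + 1 = 1 then (1 : L) else 0)
        (Matrix.of fun i j : Fin 3 => if i.val + j.val + 1 = 3 then (1 : L) else 0) endoForm_antidiagOne γH) :
    (∏ᶠ v : HeightOneSpectrum (𝓞 ↥(maximalRealSubfield L)), finTau L v (rationalComponent L γH v) μ) * archTau L (rationalArch L γH) μ = 1 := by
  have key := archHeckeValue_div_mul_finprod_finHeckeValue_div_eq_one L μ (Units.mk0 _ (gammaTwo_ne_zero L γH))
    (Units.mk0 _ (tauArg_ne_zero L γH hreg))
  simp only [Units.val_mk0] at key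
  rw [finprod_congr fun v => finTau_rationalComponent L v γH μ, archTau_rationalArch, mul_comm]
  exact key

/-- **`D`-PART: `(∏_v D_{G∕H,v}((γ_H)_v)) · D_{G∕H,∞}(γ_H ⊗ 1) = 1`** for a rational `G`-regular `γ_H` (★ `finWeylRatio_rationalComponent`, ★ `archWeylRatio_rationalArch`,
`prod_norm_embedding_mul_finprod_sqrt_eq_one`). [cite: Rogawski1990, §4.9 p. 55; §14.6 p. 242] -/
theorem finprod_finWeylRatio_mul_archWeylRatio_eq_one
    (hreg : IsGRegular (cmConjRingHom L) (Matrix.of fun i j : Fin 2 => if i.val + j.val + 1 = 2 then (1 : L) else 0)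
        (Matrix.of fun i j : Fin 1 => if i.val + j.val + 1 = 1 then (1 : L) else 0)
        (Matrix.of fun i j : Fin 3 => if i.val + j.val + 1 = 3 then (1 : L) else 0) endoForm_antidiagOne γH) :
    (∏ᶠ v : HeightOneSpectrum (𝓞 ↥(maximalRealSubfield L)), finWeylRatio L v (rationalComponent L γH v)) * archWeylRatio L (rationalArch L γH) = 1 := by
  rw [finprod_congr fun v => finWeylRatio_rationalComponent L v γH, archWeylRatio_rationalArch, mul_comm]
  exact prod_norm_embedding_mul_finprod_sqrt_eq_one L (eval_charpoly_gammaTwo_ne_zero_of_isGRegular L γH hreg)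

variable (γ : (UnitaryGroup.cmDatum L 3 H').Rational)

/-- `θ ≠ 0`. [folklore] -/
private theorem cmQuadraticGenerator_ne_zero : (cmQuadraticGenerator L : ↥(maximalRealSubfield L)) ≠ 0 := fun h =>
  not_isSquare_cmQuadraticGenerator L (by rw [h]; exact IsSquare.zero)

/-- **`κ`-PART: `(∏_v κ_v((γ_H)_v, γ_v)) · ∏_w κ‴_w(γ_H ⊗ 1, γ ⊗ 1) = 1`** on a rational `G`-regular matching pair (`c`-hermitian anisotropic `H′`): all the
`κ`'s are the local symbols `(x, θ)_v`, `(x, θ)_{w|L⁺}` of one `x ∈ (L⁺)ˣ` (`exists_kappa_eq_hilbertSymbol`), the complex places of `L` are the infinite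
places of `L⁺` (Mathlib `IsCMField.equivInfinitePlace`), and Hilbert reciprocity (★ `finprod_hilbertSymbol_mul_prod_infinitePlace_hilbertSymbol_eq_one`)
closes.  Print: «`Π_v Δ_v(γ, γ) = 1`», the `κ`-factor. [cite: Rogawski1990, §14.6 p. 242] [cite: Omeara1963, §71 Thm. 71:18] -/
theorem finprod_finKappaAt_mul_prod_archKappaSignAt_eq_one (hherm : (H'.map (cmConjRingHom L)).transpose = H')
    (hanis : ∀ x : Fin 3 → L, hermForm (cmConjRingHom L) H' x x = 0 → x = 0)
    (hreg : IsGRegular (cmConjRingHom L) (Matrix.of fun i j : Fin 2 => if i.val + j.val + 1 = 2 then (1 : L) else 0)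
        (Matrix.of fun i j : Fin 1 => if i.val + j.val + 1 = 1 then (1 : L) else 0)
        (Matrix.of fun i j : Fin 3 => if i.val + j.val + 1 = 3 then (1 : L) else 0) endoForm_antidiagOne γH)
    (hγ : IsNormPair L H' γH γ) :
    (∏ᶠ v : HeightOneSpectrum (𝓞 ↥(maximalRealSubfield L)),
        finKappaAt L v H' (rationalComponent L γH v) ((UnitaryGroup.cmDatum L 3 H').toLocal v ((UnitaryGroup.cmDatum L 3 H').toAdelic γ))) *
      ∏ w : {w : InfinitePlace L // IsComplex w}, archKappaSignAt L H' (rationalArch L γH) w (cmRationalToArch L 3 H' γ) = 1 := by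
  obtain ⟨x, hx0, hfin, harch⟩ := exists_kappa_eq_hilbertSymbol L H' γH γ hherm hanis hreg hγ
  have hx0' : (x : ↥(maximalRealSubfield L)) ≠ 0 := hx0
  rw [finprod_congr hfin, Finset.prod_congr rfl fun w _ => harch w]
  have hcoe : ∀ v : HeightOneSpectrum (𝓞 ↥(maximalRealSubfield L)),
      QuadraticForms.hilbertSymbol (v.adicCompletion ↥(maximalRealSubfield L)) (x : v.adicCompletion ↥(maximalRealSubfield L))
          ((cmQuadraticGenerator L : ↥(maximalRealSubfield L)) : v.adicCompletion ↥(maximalRealSubfield L)) =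
        QuadraticForms.hilbertSymbol (v.adicCompletion ↥(maximalRealSubfield L)) (algebraMap _ _ x)
          (algebraMap _ _ (cmQuadraticGenerator L : ↥(maximalRealSubfield L))) := fun v => by
    rw [algebraMap_adicCompletion_apply, algebraMap_adicCompletion_apply]
  rw [finprod_congr hcoe,
    Fintype.prod_equiv ((Equiv.subtypeUnivEquiv fun w : InfinitePlace L => IsTotallyComplex.isComplex w).trans (IsCMField.equivInfinitePlace L))
      (fun w : {w : InfinitePlace L // IsComplex w} =>
        QuadraticForms.hilbertSymbol (IsCMField.equivInfinitePlace L w.1).Completion (algebraMap ↥(maximalRealSubfield L) _ x)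
          (algebraMap ↥(maximalRealSubfield L) _ (cmQuadraticGenerator L : ↥(maximalRealSubfield L))))
      (fun w' : InfinitePlace ↥(maximalRealSubfield L) =>
        QuadraticForms.hilbertSymbol w'.Completion (algebraMap ↥(maximalRealSubfield L) _ x)
          (algebraMap ↥(maximalRealSubfield L) _ (cmQuadraticGenerator L : ↥(maximalRealSubfield L))))
      fun w => rfl]
  exact finprod_hilbertSymbol_mul_prod_infinitePlace_hilbertSymbol_eq_one ↥(maximalRealSubfield L) hx0' (cmQuadraticGenerator_ne_zero L)

/-- **THE PRODUCT FORMULA FOR ROGAWSKI'S EXPLICIT COLLECTION** (node N4 of `F0/P3a/T6b-TREE.md` §9): for a `c`-hermitian anisotropic `H′`, the finite explicit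
collection `(Δ‴_v)_v` (★ `finExplicitCollection`, any invariance families `hl hr`) and the canonical archimedean factor `Δ‴_∞ = c(H′)·Δ″_∞` (★ `archCanonicalDelta`)
satisfy ★ `SatisfiesProductFormula`: `(∏ᶠ_v Δ‴_v(γ_H, γ)) · Δ‴_∞(γ_H ⊗ 1, γ ⊗ 1) = 1` on every rational matching `G`-regular pair — the three factors `τ`, `D_{G∕H}`,
`κ` die separately by the Hecke, Artin–Whaples and Hilbert reciprocity laws.  Print: «By a global property of transfer factors (cf. §4.9), `Π_v Δ′_v(γ, i(γ)) = 1`»,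
«`Π_v Δ_v(γ, γ) = 1`». [cite: Rogawski1990, §14.6 p. 242; §4.3 (4.3.3) p. 44] [cite: LanglandsShelstad1987, §6.4] -/
theorem satisfiesProductFormula_finExplicitCollection (hherm : (H'.map (cmConjRingHom L)).transpose = H')
    (hanis : ∀ x : Fin 3 → L, hermForm (cmConjRingHom L) H' x x = 0 → x = 0)
    (hl : ∀ (v : HeightOneSpectrum (𝓞 ↥(maximalRealSubfield L)))
      (a : (UnitaryGroup.cmDatum L 2 (Matrix.of fun i j : Fin 2 => if i.val + j.val + 1 = 2 then (1 : L) else 0)).Local v ×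
      (UnitaryGroup.cmDatum L 1 (Matrix.of fun i j : Fin 1 => if i.val + j.val + 1 = 1 then (1 : L) else 0)).Local v)
      (b : (UnitaryGroup.cmDatum L 3 H').Local v)
      (x : (UnitaryGroup.cmDatum L 2 (Matrix.of fun i j : Fin 2 => if i.val + j.val + 1 = 2 then (1 : L) else 0)).Local v ×
      (UnitaryGroup.cmDatum L 1 (Matrix.of fun i j : Fin 1 => if i.val + j.val + 1 = 1 then (1 : L) else 0)).Local v),
      finExplicitDelta L v H' (x * a * x⁻¹) μ b = finExplicitDelta L v H' a μ b)
    (hr : ∀ (v : HeightOneSpectrum (𝓞 ↥(maximalRealSubfield L)))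
      (a : (UnitaryGroup.cmDatum L 2 (Matrix.of fun i j : Fin 2 => if i.val + j.val + 1 = 2 then (1 : L) else 0)).Local v ×
      (UnitaryGroup.cmDatum L 1 (Matrix.of fun i j : Fin 1 => if i.val + j.val + 1 = 1 then (1 : L) else 0)).Local v)
      (b y : (UnitaryGroup.cmDatum L 3 H').Local v),
      finExplicitDelta L v H' a μ (y * b * y⁻¹) = finExplicitDelta L v H' a μ b) :
    SatisfiesProductFormula L H' (finExplicitCollection L H' μ hl hr) (fun a b => archCanonicalDelta L H' a μ b) := by
  intro γH γ hreg hγ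
  have hp : ∀ v, IsLocalNormPair L H' v (rationalComponent L γH v)
      ((UnitaryGroup.cmDatum L 3 H').toLocal v ((UnitaryGroup.cmDatum L 3 H').toAdelic γ)) :=
    fun v => isLocalNormPair_rationalComponent_toLocal_toAdelic hγ v
  have hparch := isArchNormPair_rationalArch_cmRationalToArch hγ
  -- the finite product is the product of the explicit factors at the rational components
  change (∏ᶠ v : HeightOneSpectrum (𝓞 ↥(maximalRealSubfield L)),
      finExplicitDelta L v H' (rationalComponent L γH v) μ ((UnitaryGroup.cmDatum L 3 H').toLocal v ((UnitaryGroup.cmDatum L 3 H').toAdelic γ))) *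
    archCanonicalDelta L H' (rationalArch L γH) μ (cmRationalToArch L 3 H' γ) = 1
  rw [finprod_congr fun v => finExplicitDelta_of_isLocalNormPair L v H' (rationalComponent L γH v) μ (hp v),
    archCanonicalDelta_of_isArchNormPair L H' (rationalArch L γH) μ hparch]
  -- finiteness of the three supports
  have hτf : (Function.mulSupport fun v : HeightOneSpectrum (𝓞 ↥(maximalRealSubfield L)) => finTau L v (rationalComponent L γH v) μ).Finite := by
    have h1 := finite_mulSupport_finHeckeValue_algebraMap L μ (Units.mk0 _ (gammaTwo_ne_zero L γH))
    have h2 := finite_mulSupport_finHeckeValue_algebraMap L μ (Units.mk0 _ (tauArg_ne_zero L γH hreg))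
    refine (h1.union h2).subset fun v hv => ?_
    simp only [Function.mem_mulSupport, ne_eq] at hv
    by_contra hv'
    rw [Set.mem_union, not_or, Function.notMem_mulSupport, Function.notMem_mulSupport, Units.val_mk0, Units.val_mk0] at hv'
    refine hv ?_
    rw [finTau_rationalComponent, hv'.1, hv'.2, inv_one, mul_one]
  have hDf : (Function.mulSupport fun v : HeightOneSpectrum (𝓞 ↥(maximalRealSubfield L)) =>
      ((finWeylRatio L v (rationalComponent L γH v) : ℝ) : ℂ)).Finite := by
    refine (eventually_cofinite.1 (eventually_prod_placesOver_norm_coe_eq_one (↥(maximalRealSubfield L)) (E := L)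
      (eval_charpoly_gammaTwo_ne_zero_of_isGRegular L γH hreg))).subset fun v hv => ?_
    simp only [Function.mem_mulSupport, ne_eq] at hv
    by_contra hv'
    rw [Set.mem_setOf_eq, not_not] at hv'
    refine hv ?_
    rw [finWeylRatio_rationalComponent]
    have h1 : (∏ w : UnitaryGroup.PlacesOver L v, ‖algebraMap L (w.1.adicCompletion L)
        (((γH.1.val.val : Matrix (Fin 2) (Fin 2) L).charpoly).eval ((γH.2.val.val : Matrix (Fin 1) (Fin 1) L) 0 0))‖) = 1 := by
      rw [← hv']
      exact Finset.prod_congr rfl fun w _ => by rw [algebraMap_adicCompletion_apply]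
    rw [h1, Real.sqrt_one, Complex.ofReal_one]
  obtain ⟨x, hx0, hfin, -⟩ := exists_kappa_eq_hilbertSymbol L H' γH γ hherm hanis hreg hγ
  have hκf : (Function.mulSupport fun v : HeightOneSpectrum (𝓞 ↥(maximalRealSubfield L)) =>
      ((finKappaAt L v H' (rationalComponent L γH v) ((UnitaryGroup.cmDatum L 3 H').toLocal v ((UnitaryGroup.cmDatum L 3 H').toAdelic γ)) : ℤ) : ℂ)).Finite := by
    have hx0' : (x : ↥(maximalRealSubfield L)) ≠ 0 := hx0
    refine (eventually_cofinite.1 (eventually_hilbertSymbol_adicCompletion_eq_one ↥(maximalRealSubfield L) hx0'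
      (cmQuadraticGenerator_ne_zero L))).subset fun v hv => ?_
    simp only [Function.mem_mulSupport, ne_eq] at hv
    by_contra hv'
    rw [Set.mem_setOf_eq, not_not] at hv'
    refine hv ?_
    rw [hfin v, ← algebraMap_adicCompletion_apply, ← algebraMap_adicCompletion_apply, hv', Int.cast_one]
  -- split the finite product and regroup
  have hτ := finprod_finTau_mul_archTau_eq_one L μ γH hreg
  have hD := finprod_finWeylRatio_mul_archWeylRatio_eq_one L γH hreg
  have hκ := finprod_finKappaAt_mul_prod_archKappaSignAt_eq_one L H' γH γ hherm hanis hreg hγ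
  have hDℂ : (∏ᶠ v : HeightOneSpectrum (𝓞 ↥(maximalRealSubfield L)), ((finWeylRatio L v (rationalComponent L γH v) : ℝ) : ℂ)) *
      (archWeylRatio L (rationalArch L γH) : ℂ) = 1 := by
    have hDf' : (Function.mulSupport fun v : HeightOneSpectrum (𝓞 ↥(maximalRealSubfield L)) =>
        finWeylRatio L v (rationalComponent L γH v)).Finite :=
      hDf.subset fun v hv hv1 => hv (by
        change ((finWeylRatio L v (rationalComponent L γH v) : ℝ) : ℂ) = 1 at hv1
        change finWeylRatio L v (rationalComponent L γH v) = 1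
        exact_mod_cast hv1)
    have hmap := map_finprod Complex.ofRealHom hDf'
    simp only [Complex.ofRealHom_eq_coe] at hmap
    rw [← hmap, ← Complex.ofReal_mul, hD, Complex.ofReal_one]
  have hκℂ : (∏ᶠ v : HeightOneSpectrum (𝓞 ↥(maximalRealSubfield L)),
        ((finKappaAt L v H' (rationalComponent L γH v) ((UnitaryGroup.cmDatum L 3 H').toLocal v ((UnitaryGroup.cmDatum L 3 H').toAdelic γ)) : ℤ) : ℂ)) *
      ((∏ w : {w : InfinitePlace L // IsComplex w}, archKappaSignAt L H' (rationalArch L γH) w (cmRationalToArch L 3 H' γ) : ℤ) : ℂ) = 1 := by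
    have hκf' : (Function.mulSupport fun v : HeightOneSpectrum (𝓞 ↥(maximalRealSubfield L)) =>
        finKappaAt L v H' (rationalComponent L γH v) ((UnitaryGroup.cmDatum L 3 H').toLocal v ((UnitaryGroup.cmDatum L 3 H').toAdelic γ))).Finite :=
      hκf.subset fun v hv hv1 => hv (by
        change ((finKappaAt L v H' (rationalComponent L γH v)
          ((UnitaryGroup.cmDatum L 3 H').toLocal v ((UnitaryGroup.cmDatum L 3 H').toAdelic γ)) : ℤ) : ℂ) = 1 at hv1
        change finKappaAt L v H' (rationalComponent L γH v)
          ((UnitaryGroup.cmDatum L 3 H').toLocal v ((UnitaryGroup.cmDatum L 3 H').toAdelic γ)) = 1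
        exact_mod_cast hv1)
    have hmap := map_finprod (Int.castRingHom ℂ) hκf'
    simp only [Int.coe_castRingHom] at hmap
    rw [← hmap, ← Int.cast_mul, hκ, Int.cast_one]
  rw [finprod_mul_distrib ((hτf.union hDf).subset (Function.mulSupport_mul _ _)) hκf, finprod_mul_distrib hτf hDf]
  calc (∏ᶠ v : HeightOneSpectrum (𝓞 ↥(maximalRealSubfield L)), finTau L v (rationalComponent L γH v) μ) *
          (∏ᶠ v : HeightOneSpectrum (𝓞 ↥(maximalRealSubfield L)), ((finWeylRatio L v (rationalComponent L γH v) : ℝ) : ℂ)) *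
          (∏ᶠ v : HeightOneSpectrum (𝓞 ↥(maximalRealSubfield L)),
            ((finKappaAt L v H' (rationalComponent L γH v) ((UnitaryGroup.cmDatum L 3 H').toLocal v ((UnitaryGroup.cmDatum L 3 H').toAdelic γ)) : ℤ) : ℂ)) *
        (archTau L (rationalArch L γH) μ * (archWeylRatio L (rationalArch L γH) : ℂ) *
          ((∏ w : {w : InfinitePlace L // IsComplex w}, archKappaSignAt L H' (rationalArch L γH) w (cmRationalToArch L 3 H' γ) : ℤ) : ℂ))
      = ((∏ᶠ v : HeightOneSpectrum (𝓞 ↥(maximalRealSubfield L)), finTau L v (rationalComponent L γH v) μ) * archTau L (rationalArch L γH) μ) *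
        ((∏ᶠ v : HeightOneSpectrum (𝓞 ↥(maximalRealSubfield L)), ((finWeylRatio L v (rationalComponent L γH v) : ℝ) : ℂ)) *
          (archWeylRatio L (rationalArch L γH) : ℂ)) *
        ((∏ᶠ v : HeightOneSpectrum (𝓞 ↥(maximalRealSubfield L)),
            ((finKappaAt L v H' (rationalComponent L γH v) ((UnitaryGroup.cmDatum L 3 H').toLocal v ((UnitaryGroup.cmDatum L 3 H').toAdelic γ)) : ℤ) : ℂ)) *
          ((∏ w : {w : InfinitePlace L // IsComplex w}, archKappaSignAt L H' (rationalArch L γH) w (cmRationalToArch L 3 H' γ) : ℤ) : ℂ)) := by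
        ring
    _ = 1 := by rw [hτ, hDℂ, hκℂ, one_mul, one_mul]

end Assembly

end Literature.NumberTheory.Rogawski1990
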